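import Summits.NavierStokesRegularity.NavierStokesRegularity.Theorems.PerpetualPumpThesisBilinearOperatorSpace
import Summits.NavierStokesRegularity.NavierStokesRegularity.Theorems.PerpetualPumpThesisBilinearOperatorForm

/-!
# Stub B (`bilinearOperator`) for `PerpetualPump.Thesis`: Tao's averaged operator `B̃` as an
# honest `H⁹`-valued bilinear operator

Final file of the stub `bilinearOperator` of line `SketchIdeator2` (crux
stmt-NavierStokesRegularity-1832), proving the registered statement `stub_bilinearOperator`:
for **every** averaging datum `𝒜` (T. Tao, *Finite time blowup for an averaged three-dimensional
Navier–Stokes equation*, J. Amer. Math. Soc. 29 (2016), arXiv:1402.0290v3, (1.12)–(1.13); no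
symmetry, no cancellation) there are a map `Bop : L² × L² → L²` and a constant `K ≥ 0` such that
for `u, v ∈ H¹⁰_df` the field `Bop u v` is real, divergence free, obeys the tame bound
`‖Bop u v‖_{H⁹} ≤ K ‖u‖_{H¹⁰} ‖v‖_{H¹⁰}` (Tao, (1.14): `B̃` "obeys the same Sobolev bounds as `B`",
one derivative lost) and represents the duality form, `⟨Bop u v, w⟩ = ⟨B̃(u,v), w⟩ = 𝒜.form u v w`
for all `w ∈ H¹⁰_df`; and `Bop` is bilinear over `ℝ` on `H¹⁰_df`.

Construction (parts I–III are the support files `…BilinearOperatorWeighted/Space/Form.lean`):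
for `u, v` of finite `H¹⁰` norm, `w ↦ 𝒜.form u v w` is a bounded `ℂ`-linear functional on the
Hilbert space `L²_σ` of divergence-free fields (part III: trilinearity and the tame
`H¹⁰ × H¹⁰ × H⁻⁹` bound; part II: `L²_σ` is closed); its Riesz vector `z ∈ L²_σ`,
`⟪z, w⟫ = 𝒜.form u v w`, is unique, hence additive and real-homogeneous in `(u, v)`, lies in `H⁹`
with `‖z‖_{H⁹} ≤ K ‖u‖_{H¹⁰}‖v‖_{H¹⁰}` by the `H⁹` bootstrap of part II, and `Bop u v := Re z`
(`reL2 z`) is real, divergence free, has no larger `H⁹` norm, and pairs correctly with *real*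
divergence-free `w` because the form is real on real fields (`⟨Re z, w⟩ = ½(⟪z,w⟫ + conj ⟪z,w⟫)`).

## References

* T. Tao, J. Amer. Math. Soc. 29 (2016), 601–674, arXiv:1402.0290v3, §1.1 (1.12)–(1.15).
-/

noncomputable section

open MeasureTheory Set Filter Topology FourierTransform
open scoped ENNReal NNReal ComplexConjugate InnerProductSpace SchwartzMap

set_option linter.dupNamespace false

namespace Summit.NavierStokesRegularity.NavierStokesRegularity.Theorems.PerpetualPumpThesis.B

open Literature.Analysis.FluidPDE Literature.Analysis.FluidPDE.Tao2016
open Literature.Analysis.FunctionSpaces (eFourierSobolevNorm)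

/-! ### Uniqueness of Riesz vectors in `L²_σ` -/

/-- **Riesz vectors in `L²_σ` are unique**: two divergence-free fields with the same inner products
against all divergence-free fields coincide. -/
theorem eq_of_forall_inner_eq {z z' : L2C} (hz : IsFourierDivFree z) (hz' : IsFourierDivFree z')
    (h : ∀ w : L2C, IsFourierDivFree w → ⟪z, w⟫_ℂ = ⟪z', w⟫_ℂ) : z = z' := by
  have hd : IsFourierDivFree (z - z') := by
    rw [sub_eq_add_neg, ← neg_one_smul ℂ z']
    exact hz.add (hz'.smul _)
  have h0 : ⟪z - z', z - z'⟫_ℂ = 0 := by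
    rw [inner_sub_left, h _ hd, sub_self]
  exact sub_eq_zero.1 (inner_self_eq_zero.1 h0)

/-! ### The bounded functional `w ↦ ⟨B̃(u,v), w⟩` on `L²_σ` and its Riesz vector -/

/-- The real-valued form of the tame bound: `|⟨B̃(u,v), w⟩| ≤ (K ‖u‖_{H¹⁰} ‖v‖_{H¹⁰}) ‖w‖_{L²}`
for `u, v` of finite `H¹⁰` norm (`‖w‖_{H⁻⁹} ≤ ‖w‖_{L²}`). -/
theorem norm_form_le (𝒜 : AveragingDatum) {K9 : ℝ≥0}
    (hK9 : ∀ u v w : L2C, eFourierSobolevNorm 10 u < ⊤ → eFourierSobolevNorm 10 v < ⊤ →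
      ‖𝒜.form u v w‖ₑ ≤ (K9 : ℝ≥0∞) * eFourierSobolevNorm 10 u * eFourierSobolevNorm 10 v *
        eFourierSobolevNorm (-9) w)
    {u v : L2C} (hu : eFourierSobolevNorm 10 u < ∞) (hv : eFourierSobolevNorm 10 v < ∞) (w : L2C) :
    ‖𝒜.form u v w‖ ≤ ((K9 : ℝ≥0∞) * eFourierSobolevNorm 10 u * eFourierSobolevNorm 10 v).toReal * ‖w‖ := by
  have hfin : (K9 : ℝ≥0∞) * eFourierSobolevNorm 10 u * eFourierSobolevNorm 10 v ≠ ∞ :=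
    (ENNReal.mul_lt_top (ENNReal.mul_lt_top ENNReal.coe_lt_top hu) hv).ne
  have h := (hK9 u v w hu hv).trans (mul_le_mul' le_rfl (eFourierSobolevNorm_neg_nine_le_enorm w))
  have h' := ENNReal.toReal_mono (ENNReal.mul_ne_top hfin enorm_ne_top) h
  rwa [toReal_enorm, ENNReal.toReal_mul, toReal_enorm] at h'

/-- **The Riesz vector of `⟨B̃(u,v), ·⟩` in `L²_σ`**: for `u, v` of finite `H¹⁰` norm there is a
divergence-free `z ∈ L²(ℝ³; ℂ³)` with `⟪z, w⟫ = ⟨B̃(u,v), w⟩` for every divergence-free `w ∈ L²`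
(Fréchet–Riesz on the Hilbert space `L²_σ`, for the bounded `ℂ`-linear functional
`w ↦ 𝒜.form u v w`). -/
theorem exists_riesz (𝒜 : AveragingDatum) {K9 : ℝ≥0}
    (hK9 : ∀ u v w : L2C, eFourierSobolevNorm 10 u < ⊤ → eFourierSobolevNorm 10 v < ⊤ →
      ‖𝒜.form u v w‖ₑ ≤ (K9 : ℝ≥0∞) * eFourierSobolevNorm 10 u * eFourierSobolevNorm 10 v *
        eFourierSobolevNorm (-9) w)
    {u v : L2C} (hu : eFourierSobolevNorm 10 u < ∞) (hv : eFourierSobolevNorm 10 v < ∞) :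
    ∃ z : L2C, IsFourierDivFree z ∧ ∀ w : L2C, IsFourierDivFree w → ⟪z, w⟫_ℂ = 𝒜.form u v w := by
  obtain ⟨Kσ, hKσ⟩ := exists_submodule_mem_iff_isFourierDivFree
  haveI : CompleteSpace Kσ := completeSpace_of_mem_iff_isFourierDivFree Kσ hKσ
  -- the functional on `L²_σ`
  let f : Kσ →ₗ[ℂ] ℂ :=
    { toFun := fun w => 𝒜.form u v (w : L2C)
      map_add' := fun w w' => by
        simp only [Submodule.coe_add]
        exact form_add₃ 𝒜 _ _ hu hv
      map_smul' := fun c w => by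
        simp only [Submodule.coe_smul, RingHom.id_apply, smul_eq_mul]
        exact form_smul₃ 𝒜 c _ hu hv }
  have hb : ∃ C, ∀ w : Kσ, ‖f w‖ ≤ C * ‖w‖ :=
    ⟨((K9 : ℝ≥0∞) * eFourierSobolevNorm 10 u * eFourierSobolevNorm 10 v).toReal, fun w => by
      rw [Submodule.coe_norm]
      exact norm_form_le 𝒜 hK9 hu hv (w : L2C)⟩
  let ℓ : Kσ →L[ℂ] ℂ := f.mkContinuousOfExistsBound hb
  refine ⟨((InnerProductSpace.toDual ℂ Kσ).symm ℓ : Kσ), (hKσ _).1 (Submodule.coe_mem _),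
    fun w hw => ?_⟩
  have hw' : w ∈ Kσ := (hKσ w).2 hw
  change ⟪(((InnerProductSpace.toDual ℂ Kσ).symm ℓ : Kσ) : L2C), ((⟨w, hw'⟩ : Kσ) : L2C)⟫_ℂ = _
  rw [← Submodule.coe_inner, InnerProductSpace.toDual_symm_apply]
  rfl

/-! ### The real part of the Riesz vector pairs correctly and lies in `H⁹` -/

/-- `⟪z̄, w⟫ = conj ⟪z, w⟫` for a real field `w`. -/
theorem inner_conjL2_left_eq {z w : L2C} (hw : IsReal w) : ⟪conjL2 z, w⟫_ℂ = conj ⟪z, w⟫_ℂ := by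
  rw [← pairing_eq_inner_conjL2 w z, pairing_swap, pairing_eq_inner_conjL2 z w, hw.conjL2_eq]
  exact (inner_conj_symm w z).symm

/-- **The real part of the Riesz vector represents the form on real fields**: if
`⟪z, w⟫ = ⟨B̃(u,v), w⟩` with `u, v, w` real, then `⟨Re z, w⟩ = ⟨B̃(u,v), w⟩` (the form is real on real
fields, so `⟨Re z, w⟩ = ½(⟪z,w⟫ + conj ⟪z,w⟫) = ⟪z,w⟫`). -/
theorem pairing_reL2_eq (𝒜 : AveragingDatum) {u v w z : L2C} (hu : IsReal u) (hv : IsReal v)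
    (hw : IsReal w) (hz : ⟪z, w⟫_ℂ = 𝒜.form u v w) : pairing (reL2 z) w = 𝒜.form u v w := by
  have hreal : conj (𝒜.form u v w) = 𝒜.form u v w :=
    Complex.conj_eq_iff_im.2 (form_im_eq_zero 𝒜 hu hv hw)
  rw [(isReal_reL2 z).pairing_eq_inner, reL2, inner_smul_left, inner_add_left,
    inner_conjL2_left_eq hw, hz, hreal, map_inv₀, map_ofNat]
  ring

/-- **The real part of the Riesz vector lies in `H⁹`** with the tame bound
`‖Re z‖_{H⁹} ≤ K ‖u‖_{H¹⁰} ‖v‖_{H¹⁰}` (the `H⁹` bootstrap of part II applied to the tame bound of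
part III, and `‖Re z‖_{H⁹} ≤ ‖z‖_{H⁹}`). -/
theorem eFourierSobolevNorm_reL2_riesz_le (𝒜 : AveragingDatum) {K9 : ℝ≥0}
    (hK9 : ∀ u v w : L2C, eFourierSobolevNorm 10 u < ⊤ → eFourierSobolevNorm 10 v < ⊤ →
      ‖𝒜.form u v w‖ₑ ≤ (K9 : ℝ≥0∞) * eFourierSobolevNorm 10 u * eFourierSobolevNorm 10 v *
        eFourierSobolevNorm (-9) w)
    {u v z : L2C} (hu : eFourierSobolevNorm 10 u < ∞) (hv : eFourierSobolevNorm 10 v < ∞)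
    (hz : IsFourierDivFree z) (hriesz : ∀ w : L2C, IsFourierDivFree w → ⟪z, w⟫_ℂ = 𝒜.form u v w) :
    eFourierSobolevNorm 9 (reL2 z) ≤ (K9 : ℝ≥0∞) * eFourierSobolevNorm 10 u * eFourierSobolevNorm 10 v := by
  refine (eFourierSobolevNorm_reL2_le 9 z).trans
    (eFourierSobolevNorm_nine_le_of_inner_bound hz fun w hw => ?_)
  rw [hriesz w hw]
  exact hK9 u v w hu hv

end Summit.NavierStokesRegularity.NavierStokesRegularity.Theorems.PerpetualPumpThesis.B

namespace Summit.NavierStokesRegularity.NavierStokesRegularity.Theorems.PerpetualPumpThesis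

open Literature.Analysis.FluidPDE Literature.Analysis.FluidPDE.Tao2016
open Literature.Analysis.FunctionSpaces

/-- **Stub B (`BilinearOperator`)** of line `SketchIdeator2` for `PerpetualPump.Thesis`: for every
averaging datum `𝒜` (Tao 2016, (1.12)–(1.13)), Tao's averaged Euler bilinear operator `B̃`, defined
by duality, is represented on `H¹⁰_df × H¹⁰_df` by an honest `L²`-valued map `Bop` with constant
`K ≥ 0`: `Bop u v` is real and divergence free, obeys the tame one-derivative-loss bound
`‖Bop u v‖_{H⁹} ≤ K ‖u‖_{H¹⁰} ‖v‖_{H¹⁰}` (Tao, (1.14)), pairs with every `w ∈ H¹⁰_df` to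
`⟨B̃(u,v), w⟩ = 𝒜.form u v w`, and `Bop` is additive and real-homogeneous in each argument on
`H¹⁰_df`. (`Bop u v` is the real part of the Riesz vector of `w ↦ 𝒜.form u v w` in the Hilbert
space of divergence-free `L²` fields.) -/
theorem stub_bilinearOperator :
    ∀ 𝒜 : AveragingDatum, ∃ (Bop : L2C → L2C → L2C) (K : ℝ), 0 ≤ K ∧
      (∀ u v : L2C, MemH10df u → MemH10df v →
        IsReal (Bop u v) ∧ IsFourierDivFree (Bop u v) ∧
        eFourierSobolevNorm 9 (Bop u v) ≤
          ENNReal.ofReal K * eFourierSobolevNorm 10 u * eFourierSobolevNorm 10 v ∧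
        ∀ w : L2C, MemH10df w → pairing (Bop u v) w = 𝒜.form u v w) ∧
      (∀ u u' v : L2C, MemH10df u → MemH10df u' → MemH10df v →
        Bop (u + u') v = Bop u v + Bop u' v ∧ Bop v (u + u') = Bop v u + Bop v u') ∧
      (∀ (c : ℝ) (u v : L2C), MemH10df u → MemH10df v →
        Bop ((c : ℂ) • u) v = (c : ℂ) • Bop u v ∧ Bop u ((c : ℂ) • v) = (c : ℂ) • Bop u v) := by
  intro 𝒜
  obtain ⟨K9, hK9⟩ := B.exists_enorm_form_le 𝒜
  -- Riesz vectors of `w ↦ ⟨B̃(u,v), w⟩` in `L²_σ` (junk `0` off the fields of finite `H¹⁰` norm)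
  have hz : ∀ u v : L2C, ∃ z : L2C, eFourierSobolevNorm 10 u < ∞ → eFourierSobolevNorm 10 v < ∞ →
      IsFourierDivFree z ∧ ∀ w : L2C, IsFourierDivFree w → ⟪z, w⟫_ℂ = 𝒜.form u v w := by
    intro u v
    by_cases h : eFourierSobolevNorm 10 u < ∞ ∧ eFourierSobolevNorm 10 v < ∞
    · obtain ⟨z, hz⟩ := B.exists_riesz 𝒜 hK9 h.1 h.2
      exact ⟨z, fun _ _ => hz⟩
    · exact ⟨0, fun hu hv => (h ⟨hu, hv⟩).elim⟩
  choose z hz using hz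
  refine ⟨fun u v => reL2 (z u v), (K9 : ℝ), K9.coe_nonneg, ?_, ?_, ?_⟩
  · -- realness, divergence, the `H⁹` bound and the pairing identity
    intro u v hu hv
    obtain ⟨hzdf, hzr⟩ := hz u v hu.1 hv.1
    refine ⟨isReal_reL2 _, B.isFourierDivFree_reL2 hzdf, ?_,
      fun w hw => B.pairing_reL2_eq 𝒜 hu.2.1 hv.2.1 hw.2.1 (hzr w hw.2.2)⟩
    rw [ENNReal.ofReal_coe_nnreal]
    exact B.eFourierSobolevNorm_reL2_riesz_le 𝒜 hK9 hu.1 hv.1 hzdf hzr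
  · -- additivity in each slot (uniqueness of Riesz vectors, additivity of the form)
    intro u u' v hu hu' hv
    have huu' : eFourierSobolevNorm 10 (u + u') < ∞ := eFourierSobolevNorm_add_lt_top hu.1 hu'.1
    constructor
    · show reL2 (z (u + u') v) = reL2 (z u v) + reL2 (z u' v)
      rw [← B.reL2_add]
      congr 1
      obtain ⟨h1, h1r⟩ := hz (u + u') v huu' hv.1
      obtain ⟨h2, h2r⟩ := hz u v hu.1 hv.1
      obtain ⟨h3, h3r⟩ := hz u' v hu'.1 hv.1
      refine B.eq_of_forall_inner_eq h1 (h2.add h3) fun w hw => ?_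
      rw [inner_add_left, h1r w hw, h2r w hw, h3r w hw]
      exact B.form_add₁ 𝒜 w hu.1 hu'.1 hv.1
    · show reL2 (z v (u + u')) = reL2 (z v u) + reL2 (z v u')
      rw [← B.reL2_add]
      congr 1
      obtain ⟨h1, h1r⟩ := hz v (u + u') hv.1 huu'
      obtain ⟨h2, h2r⟩ := hz v u hv.1 hu.1
      obtain ⟨h3, h3r⟩ := hz v u' hv.1 hu'.1
      refine B.eq_of_forall_inner_eq h1 (h2.add h3) fun w hw => ?_
      rw [inner_add_left, h1r w hw, h2r w hw, h3r w hw]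
      exact B.form_add₂ 𝒜 w hv.1 hu.1 hu'.1
  · -- real homogeneity in each slot
    intro c u v hu hv
    have hcu : eFourierSobolevNorm 10 ((c : ℂ) • u) < ∞ := eFourierSobolevNorm_smul_lt_top hu.1 _
    have hcv : eFourierSobolevNorm 10 ((c : ℂ) • v) < ∞ := eFourierSobolevNorm_smul_lt_top hv.1 _
    constructor
    · show reL2 (z ((c : ℂ) • u) v) = (c : ℂ) • reL2 (z u v)
      rw [← B.reL2_smul_real]
      congr 1
      obtain ⟨h1, h1r⟩ := hz ((c : ℂ) • u) v hcu hv.1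
      obtain ⟨h2, h2r⟩ := hz u v hu.1 hv.1
      refine B.eq_of_forall_inner_eq h1 (h2.smul _) fun w hw => ?_
      rw [inner_smul_left, h1r w hw, h2r w hw, Complex.conj_ofReal]
      exact B.form_smul₁ 𝒜 (c : ℂ) u v w
    · show reL2 (z u ((c : ℂ) • v)) = (c : ℂ) • reL2 (z u v)
      rw [← B.reL2_smul_real]
      congr 1
      obtain ⟨h1, h1r⟩ := hz u ((c : ℂ) • v) hu.1 hcv
      obtain ⟨h2, h2r⟩ := hz u v hu.1 hv.1
      refine B.eq_of_forall_inner_eq h1 (h2.smul _) fun w hw => ?_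
      rw [inner_smul_left, h1r w hw, h2r w hw, Complex.conj_ofReal]
      exact B.form_smul₂ 𝒜 (c : ℂ) u v w

end Summit.NavierStokesRegularity.NavierStokesRegularity.Theorems.PerpetualPumpThesis
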